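import Summits.ResolutionOfSingularities.ResolutionOfSingularities.Theorems.WeightedInvariantContactCylinderOpenClause
import Summits.ResolutionOfSingularities.ResolutionOfSingularities.Theorems.WeightedInvariantContactCylinderLocalize
import Summits.ResolutionOfSingularities.ResolutionOfSingularities.Theorems.WeightedInvariantP3tDrop
import HarnessLib

/-!
# (open″)≤3 for the pair of record `(ι₃ᵗ, J₃ᵗ) = (Iota3.iotaFlatT, Iota3.jFlatT)` — THE CYLINDER-TYPE BODY: from the
# `ι₀`-stratum iff and a presentation of the `jContact`-cylinder along a centre prime `𝔭` with `dim A_𝔭 ≤ 2`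
# (door `HypersurfaceCentreConstruction`, stmt-ResolutionOfSingularities-19897; P3 rung clause h8
# `JOpenPresentationForallSingLE 3 p Iota3.iotaFlatT Iota3.jFlatT`; DEAL (o52) SPLIT of res-L1-w43-plan-1 2026-08-27T15:54:33Z,
# hand res-D-brk-1: (o52-A) CURVE + (o52-C) height one + (o52-asm))

Topic: `Summits/ResolutionOfSingularities/ResolutionOfSingularities/Theorems`. Helper for the door item
`HypersurfaceCentreConstruction` (stmt-ResolutionOfSingularities-19897, route `WeightedInvariant`), line `local-engine`
(L W4.3), def-free.  The COMMON ENGINE behind the two cylinder-type regimes of the (open″)≤3 clause for the pair of record —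
(o52-C) «height-one / divisorial top stratum» and (o52-A) «curve top stratum» — generalising res-D-brk-1's
`ContactCylinder.jOpenPresentation_body_cylinder` (p528319, pair `(ι, jCylinder ι jContact)`) to the v1.3 pair
`ι₃ᵗ = iotaLex _ ι₀ (iotaCylinder ι₀ σ)`, `J₃ᵗ = jCylinder ι₀ jFlatCoreE` (`ι₀ = iotaOrdEpsTau`, res-type-013 p532999;
res-type-061 p531207 / `…P3tDrop`), and to the DIMENSION GUARD of `JOpenPresentationForallSingLE d` (the model prime `𝔪` need
not be closed: only the primes `𝔮 ∈ D(h)` with `dim A_𝔮 ≤ 3` are probed, and only there are the letters `ε, τ, σ` controlled).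

THE POSITION.  `k` perfect, `A` of finite type over `k`, primes `𝔭 ≤ 𝔪`, `A_𝔪` regular, `dim A_𝔭 ≤ 2`; a positively weighted
system `U : Fin N → A`, `W` with `(U) A_𝔪 = 𝔭 A_𝔪` and independent differentials at `A_𝔪`; `ord_{A_𝔪} F ≥ 2`.
TWO INPUTS, both on basic opens `∋ 𝔪` and only at primes of local dimension `≤ 3`:
(ι₀-IFF) `𝔭 ≤ 𝔮 ↔ (F ∈ 𝔪_{A_𝔮}² ∧ ι₀ (A_𝔮) F = ι₀ (A_𝔪) F)`;
(J-PRES) for `𝔮 ⊇ 𝔭` with `A_𝔮` regular and `U` independent at `𝔮`: `cylinderAt jContact (A_𝔮) (𝔭 A_𝔮) F m = (U; W)_m · A_𝔮`.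
THE CONCLUSION.  Some `h ∉ 𝔪` such that at every prime `𝔮 ∌ h` with `dim A_𝔮 ≤ 3`:
`(∀ i, U i ∈ 𝔮) ↔ (F ∈ 𝔪_{A_𝔮}² ∧ ι₃ᵗ (A_𝔮) F = ι₃ᵗ (A_𝔪) F)` and `(∀ i, U i ∈ 𝔮) → ∀ m, J₃ᵗ (A_𝔮) F m = (U; W)_m · A_𝔮` —
the literal two demands of `JOpenPresentationForallSingLE 3`.
ROUTE.  On `V(𝔭) ∩ D(h) ∩ {dim ≤ 3}` the top `ι₀`-stratum of `A_𝔮` is `V(𝔭 A_𝔮)` (the ι₀-iff read at the generizations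
`𝔮₀ ⊆ 𝔮`, all of dimension `≤ dim A_𝔮 ≤ 3`, through `(A_𝔮)_{𝔮₀ A_𝔮} ≃ A_{𝔮₀}`), so the cylinder letter
`iotaCylinder ι₀ σ (A_𝔮) F = σ ((A_𝔮)_{𝔭 A_𝔮}) F = σ (A_𝔭) F` is CONSTANT along the stratum (`σ` is iso-invariant,
res-type-073 p529049) and `ι₃ᵗ` is kept exactly where `ι₀` is; and `J₃ᵗ (A_𝔮) F m = cylinderAt jContact (A_𝔮) (𝔭 A_𝔮) F m`
(`Iota3.jFlatOver_eq_cylinderAt_jContact`, `dim (A_𝔮)_{𝔭A_𝔮} = dim A_𝔭 ≤ 2`), presented by (J-PRES); regularity of `A_𝔮` and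
independence of `U` there are spread from `𝔪` (Literature `CotangentIndependenceSpread`).

## Contents (sorry-free, standard axioms; NO definitions)

* `ringKrullDim_atPrime_mono` — `𝔮₀ ≤ 𝔮 ⇒ dim A_𝔮₀ ≤ dim A_𝔮` (heights).
* `topStratum_atPrime_eq_of_stratumIffLE` — dimension-guarded form of `topStratum_atPrime_eq_of_stratumIff` (p528319).
* `iotaOrdEpsTau_eq_imp_mem_sq` — `ι₀ (A_𝔮) F = ι₀ (A_𝔪) F ⇒ F ∈ 𝔪_{A_𝔮}²` once `ord_{A_𝔪} F ≥ 2`.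
* **`jOpenPresentation_body_flat_of_stratumIff`** — the engine above.

[OURS · L1 W4.3 · (o52)]  Replaces the role of NO printed item; NOT a statement of the manuscript
[claim: Hironaka2017, status: under-review]. AI work, weaker than expert review.  Pure commutative algebra; no named facts.

## References

* H. Matsumura, *Commutative Ring Theory* (1987), Thm. 4.3 (primes of a localisation), §5 / Thm. 13.5 (height and dimension),
  Thm. 14.2. [Matsumura1987]
* V. Cossart, O. Piltant, J. Algebra 320 (2008), Prop. 4.2 (generic behaviour of a local invariant along a regular prime).
  [CossartPiltant2008]
* res-L1-w43-plan-1, IOTA3-DESIGN v1.3 §8.2–§8.4 and DEAL (o52) SPLIT (OURS, AI planning).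
-/

noncomputable section

open IsLocalRing Literature.AlgebraicGeometry.Resolution
open Summit.ResolutionOfSingularities.ResolutionOfSingularities.Cruxes.HypersurfaceCentreConstruction.LocalEngine
open Summit.ResolutionOfSingularities.ResolutionOfSingularities.Cruxes.HypersurfaceCentreConstruction.LocalEngine.Iota3

set_option linter.dupNamespace false -- mandated namespace of this single-conjunct summit

namespace Summit.ResolutionOfSingularities.ResolutionOfSingularities.Theorems

namespace JOpenLE3

open ContactCylinder

/-! ## Dimension bookkeeping along generizations -/

/-- `𝔮₀ ≤ 𝔮 ⇒ dim A_𝔮₀ ≤ dim A_𝔮` (`dim A_𝔮 = ht 𝔮`, heights are monotone). [cite: Matsumura1987, Thm. 13.5] -/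
theorem ringKrullDim_atPrime_mono {A : Type} [CommRing A] (𝔮₀ 𝔮 : Ideal A) [𝔮₀.IsPrime] [𝔮.IsPrime] (h : 𝔮₀ ≤ 𝔮) :
    ringKrullDim (Localization.AtPrime 𝔮₀) ≤ ringKrullDim (Localization.AtPrime 𝔮) := by
  rw [IsLocalization.AtPrime.ringKrullDim_eq_height 𝔮₀ (Localization.AtPrime 𝔮₀),
    IsLocalization.AtPrime.ringKrullDim_eq_height 𝔮 (Localization.AtPrime 𝔮)]
  exact_mod_cast Ideal.height_mono h

/-! ## The top `ι`-stratum of `A_𝔮` along the stratum, dimension-guarded -/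

/-- **The top `ι`-stratum of `A_𝔮` is `V(𝔭 A_𝔮)` at the points `𝔮 ⊇ 𝔭` of local dimension `≤ d` of a basic open carrying
the dimension-guarded stratum iff.**  `ι` iso-invariant; on `D(h₁) ∩ {dim ≤ d}`: `𝔭 ≤ 𝔮₀ ↔ (F ∈ 𝔪_{A_𝔮₀}² ∧
ι (A_𝔮₀) F = ι (A_𝔪) F)`; on `D(h₂) ∩ {dim ≤ d}`: `ι (A_𝔮₀) F = ι (A_𝔪) F → F ∈ 𝔪_{A_𝔮₀}²`.  Then for `𝔮 ⊇ 𝔭` with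
`h₁, h₂ ∉ 𝔮` and `dim A_𝔮 ≤ d`: `topStratum ι (A_𝔮) (F/1) = {𝔮₀' | 𝔭 A_𝔮 ≤ 𝔮₀'}` (the primes `𝔮₀'` of `A_𝔮` are the primes
`𝔮₀ ⊆ 𝔮`, of dimension `≤ dim A_𝔮`, and `(A_𝔮)_{𝔮₀'} ≃ A_{𝔮₀}` carries `ι`). [OURS · L1 W4.3 · (o52)] -/
theorem topStratum_atPrime_eq_of_stratumIffLE (ι : (R : Type) → [CommRing R] → R → Ordinal.{0}) (hiso : IotaIsoInvariant ι)
    {A : Type} [CommRing A] (𝔪 𝔭 : Ideal A) [𝔪.IsPrime] [𝔭.IsPrime] (F : A) (d : ℕ) {h₁ h₂ : A}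
    (hiff : ∀ (𝔮 : Ideal A) [𝔮.IsPrime], h₁ ∉ 𝔮 → ringKrullDim (Localization.AtPrime 𝔮) ≤ d →
      (𝔭 ≤ 𝔮 ↔ (algebraMap A (Localization.AtPrime 𝔮) F ∈ maximalIdeal (Localization.AtPrime 𝔮) ^ 2 ∧
        ι (Localization.AtPrime 𝔮) (algebraMap A (Localization.AtPrime 𝔮) F) =
          ι (Localization.AtPrime 𝔪) (algebraMap A (Localization.AtPrime 𝔪) F))))
    (hsq : ∀ (𝔮 : Ideal A) [𝔮.IsPrime], h₂ ∉ 𝔮 → ringKrullDim (Localization.AtPrime 𝔮) ≤ d →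
      ι (Localization.AtPrime 𝔮) (algebraMap A (Localization.AtPrime 𝔮) F) =
          ι (Localization.AtPrime 𝔪) (algebraMap A (Localization.AtPrime 𝔪) F) →
        algebraMap A (Localization.AtPrime 𝔮) F ∈ maximalIdeal (Localization.AtPrime 𝔮) ^ 2)
    (𝔮 : Ideal A) [𝔮.IsPrime] (h𝔭𝔮 : 𝔭 ≤ 𝔮) (hh₁ : h₁ ∉ 𝔮) (hh₂ : h₂ ∉ 𝔮)
    (hdim : ringKrullDim (Localization.AtPrime 𝔮) ≤ d) :
    topStratum ι (Localization.AtPrime 𝔮) (algebraMap A (Localization.AtPrime 𝔮) F) =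
      {𝔮₀' | 𝔭.map (algebraMap A (Localization.AtPrime 𝔮)) ≤ 𝔮₀'.asIdeal} := by
  have hι𝔮 : ι (Localization.AtPrime 𝔮) (algebraMap A (Localization.AtPrime 𝔮) F) =
      ι (Localization.AtPrime 𝔪) (algebraMap A (Localization.AtPrime 𝔪) F) := ((hiff 𝔮 hh₁ hdim).mp h𝔭𝔮).2
  ext 𝔮₀'
  have hle : 𝔮₀'.asIdeal.comap (algebraMap A (Localization.AtPrime 𝔮)) ≤ 𝔮 := comap_le_of_isPrime_atPrime 𝔮 _
  have hh₁' : h₁ ∉ 𝔮₀'.asIdeal.comap (algebraMap A (Localization.AtPrime 𝔮)) := fun h => hh₁ (hle h)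
  have hh₂' : h₂ ∉ 𝔮₀'.asIdeal.comap (algebraMap A (Localization.AtPrime 𝔮)) := fun h => hh₂ (hle h)
  have hdim' : ringKrullDim (Localization.AtPrime (𝔮₀'.asIdeal.comap (algebraMap A (Localization.AtPrime 𝔮)))) ≤ d :=
    (ringKrullDim_atPrime_mono _ 𝔮 hle).trans hdim
  rw [ContactCylinder.mem_topStratum_iff, StratumIff.iota_localization_localization_eq ι hiso 𝔮 𝔮₀'.asIdeal F, hι𝔮,
    Set.mem_setOf_eq,
    Ideal.map_le_iff_le_comap]
  constructor
  · intro heq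
    exact (hiff _ hh₁' hdim').mpr ⟨hsq _ hh₂' hdim' heq, heq⟩
  · intro hle𝔭
    exact ((hiff _ hh₁' hdim').mp hle𝔭).2

/-! ## `ι₀`-equality forces `F ∈ 𝔪²` -/

/-- If `ord_{A_𝔪} F ≥ 2` then at every prime `𝔮` with `ι₀ (A_𝔮) F = ι₀ (A_𝔪) F` (`ι₀ = (ν ; ε ; τ)` begins with the
order) `F ∈ 𝔪_{A_𝔮}²`. [OURS · L1 W4.3 · (o52)] -/
theorem iotaOrdEpsTau_eq_imp_mem_sq {A : Type} [CommRing A] (𝔪 : Ideal A) [𝔪.IsPrime] (F : A)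
    (h2 : (2 : Ordinal) ≤ iotaOrd (Localization.AtPrime 𝔪) (algebraMap A (Localization.AtPrime 𝔪) F))
    (𝔮 : Ideal A) [𝔮.IsPrime]
    (heq : iotaOrdEpsTau (Localization.AtPrime 𝔮) (algebraMap A (Localization.AtPrime 𝔮) F) =
      iotaOrdEpsTau (Localization.AtPrime 𝔪) (algebraMap A (Localization.AtPrime 𝔪) F)) :
    algebraMap A (Localization.AtPrime 𝔮) F ∈ maximalIdeal (Localization.AtPrime 𝔮) ^ 2 := by
  rw [StratumIff.mem_sq_iff_two_le_iotaOrd]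
  have hν : iotaOrd (Localization.AtPrime 𝔮) (algebraMap A (Localization.AtPrime 𝔮) F) =
      iotaOrd (Localization.AtPrime 𝔪) (algebraMap A (Localization.AtPrime 𝔪) F) :=
    ((iotaOrdEps_eq_iff _ _ _ _).mp ((iotaOrdEpsTau_eq_iff _ _ _ _).mp heq).1).1
  rw [hν]
  exact h2


/-! ## The engine -/

/-- **(open″)≤3 BODY OF CYLINDER TYPE for the pair of record `(iotaFlatT, jFlatT)`.**  Position: `k` perfect, `A` of finite
type, primes `𝔭 ≤ 𝔪`, `A_𝔪` regular of dimension `≤ 3`, `dim A_𝔭 ≤ 2`, `ord_{A_𝔪} F ≥ 2`; a positively weighted system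
`(U, W)` in `A` with `(U) A_𝔪 = 𝔭 A_𝔪` and independent differentials at `A_𝔪`.  Inputs on basic opens `∋ 𝔪`, at primes of
local dimension `≤ 3` only: (ι₀-IFF) `𝔭 ≤ 𝔮 ↔ (F ∈ 𝔪_{A_𝔮}² ∧ ι₀ (A_𝔮) F = ι₀ (A_𝔪) F)` (`ι₀ = iotaOrdEpsTau`); (J-PRES)
for `𝔮 ⊇ 𝔭` with `A_𝔮` regular and `U` independent at `𝔮`: `(cylinderAt jContact A 𝔭 F m) A_𝔮 = (U; W)_m A_𝔮`.
Conclusion: some `h ∉ 𝔪` such that at every prime `𝔮 ∌ h` with `dim A_𝔮 ≤ 3`: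
`(∀ i, U i ∈ 𝔮) ↔ (F ∈ 𝔪_{A_𝔮}² ∧ iotaFlatT (A_𝔮) F = iotaFlatT (A_𝔪) F)` and
`(∀ i, U i ∈ 𝔮) → ∀ m, jFlatT (A_𝔮) F m = (U; W)_m A_𝔮` — the literal two demands of `JOpenPresentationForallSingLE 3`.
[OURS · L1 W4.3 · (o52) engine] -/
theorem jOpenPresentation_body_flat_of_stratumIff
    (k : Type) [Field k] [PerfectField k] (A : Type) [CommRing A] [Algebra k A] [Algebra.FiniteType k A]
    (𝔪 : Ideal A) [𝔪.IsPrime] [IsRegularLocalRing (Localization.AtPrime 𝔪)]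
    (hdim𝔪 : ringKrullDim (Localization.AtPrime 𝔪) ≤ 3) (F : A)
    (h2 : (2 : Ordinal) ≤ iotaOrd (Localization.AtPrime 𝔪) (algebraMap A (Localization.AtPrime 𝔪) F))
    (𝔭 : Ideal A) [𝔭.IsPrime] (h𝔭𝔪 : 𝔭 ≤ 𝔪) (hdim𝔭 : ringKrullDim (Localization.AtPrime 𝔭) ≤ 2)
    {N : ℕ} (U : Fin N → A) (W : Fin N → ℕ)
    (hU𝔭 : (Ideal.span (Set.range U)).map (algebraMap A (Localization.AtPrime 𝔪)) =
      𝔭.map (algebraMap A (Localization.AtPrime 𝔪)))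
    (hU𝔪 : ∀ i, algebraMap A (Localization.AtPrime 𝔪) (U i) ∈ maximalIdeal (Localization.AtPrime 𝔪))
    (hli𝔪 : LinearIndependent (ResidueField (Localization.AtPrime 𝔪)) fun i =>
      (maximalIdeal (Localization.AtPrime 𝔪)).toCotangent ⟨algebraMap A _ (U i), hU𝔪 i⟩)
    {h₀ : A} (hh₀ : h₀ ∉ 𝔪)
    (hpres : ∀ (𝔮 : Ideal A) [𝔮.IsPrime], h₀ ∉ 𝔮 → 𝔭 ≤ 𝔮 → ringKrullDim (Localization.AtPrime 𝔮) ≤ 3 →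
      IsRegularLocalRing (Localization.AtPrime 𝔮) →
      (∃ hU𝔮 : ∀ i, algebraMap A (Localization.AtPrime 𝔮) (U i) ∈ maximalIdeal (Localization.AtPrime 𝔮),
        LinearIndependent (ResidueField (Localization.AtPrime 𝔮)) fun i =>
          (maximalIdeal (Localization.AtPrime 𝔮)).toCotangent ⟨algebraMap A _ (U i), hU𝔮 i⟩) →
      ∀ m : ℕ, (cylinderAt jContact A 𝔭 F m).map (algebraMap A (Localization.AtPrime 𝔮)) =
        (weightedMonomialIdeal U W m).map (algebraMap A (Localization.AtPrime 𝔮)))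
    {h₁ : A} (hh₁ : h₁ ∉ 𝔪)
    (hiff₀ : ∀ (𝔮 : Ideal A) [𝔮.IsPrime], h₁ ∉ 𝔮 → ringKrullDim (Localization.AtPrime 𝔮) ≤ 3 →
      (𝔭 ≤ 𝔮 ↔ (algebraMap A (Localization.AtPrime 𝔮) F ∈ maximalIdeal (Localization.AtPrime 𝔮) ^ 2 ∧
        iotaOrdEpsTau (Localization.AtPrime 𝔮) (algebraMap A (Localization.AtPrime 𝔮) F) =
          iotaOrdEpsTau (Localization.AtPrime 𝔪) (algebraMap A (Localization.AtPrime 𝔪) F)))) :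
    ∃ h : A, h ∉ 𝔪 ∧ ∀ (𝔮 : Ideal A) [𝔮.IsPrime], h ∉ 𝔮 → ringKrullDim (Localization.AtPrime 𝔮) ≤ 3 →
      ((∀ i, U i ∈ 𝔮) ↔
        (algebraMap A (Localization.AtPrime 𝔮) F ∈ maximalIdeal (Localization.AtPrime 𝔮) ^ 2 ∧
          iotaFlatT (Localization.AtPrime 𝔮) (algebraMap A (Localization.AtPrime 𝔮) F) =
            iotaFlatT (Localization.AtPrime 𝔪) (algebraMap A (Localization.AtPrime 𝔪) F))) ∧
      ((∀ i, U i ∈ 𝔮) → ∀ m : ℕ,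
        jFlatT (Localization.AtPrime 𝔮) (algebraMap A (Localization.AtPrime 𝔮) F) m =
          (weightedMonomialIdeal U W m).map (algebraMap A (Localization.AtPrime 𝔮))) := by
  classical
  haveI : IsNoetherianRing A := Algebra.FiniteType.isNoetherianRing k A
  -- `ι₀`-equality forces `F ∈ 𝔪²`
  have hsq : ∀ (𝔮 : Ideal A) [𝔮.IsPrime], h₁ ∉ 𝔮 → ringKrullDim (Localization.AtPrime 𝔮) ≤ 3 →
      iotaOrdEpsTau (Localization.AtPrime 𝔮) (algebraMap A (Localization.AtPrime 𝔮) F) =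
          iotaOrdEpsTau (Localization.AtPrime 𝔪) (algebraMap A (Localization.AtPrime 𝔪) F) →
        algebraMap A (Localization.AtPrime 𝔮) F ∈ maximalIdeal (Localization.AtPrime 𝔮) ^ 2 :=
    fun 𝔮 _ _ _ heq => iotaOrdEpsTau_eq_imp_mem_sq 𝔪 F h2 𝔮 heq
  -- the bridge `V(U) = V(𝔭)` near `𝔪`
  have hcomap : ((Ideal.span (Set.range U)).map (algebraMap A (Localization.AtPrime 𝔪))).comap
      (algebraMap A (Localization.AtPrime 𝔪)) = 𝔭 := by
    rw [hU𝔭, comap_map_atPrime_of_le 𝔭 𝔪 h𝔭𝔪]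
  obtain ⟨hb, hhb, hbridge⟩ := StratumIff.exists_forall_le_iff_comap_le 𝔪 (Ideal.span (Set.range U))
  have hUiff : ∀ (𝔮 : Ideal A) [𝔮.IsPrime], hb ∉ 𝔮 → ((∀ i, U i ∈ 𝔮) ↔ 𝔭 ≤ 𝔮) := by
    intro 𝔮 _ hhb𝔮
    rw [← hcomap, ← hbridge 𝔮 hhb𝔮, Ideal.span_le, Set.range_subset_iff]
    rfl
  -- regularity of `A_𝔮` and independence of `U` spread from `𝔪`
  obtain ⟨f, hf𝔪, hspread⟩ := exists_notMem_forall_linearIndependent_toCotangent k 𝔪 U hU𝔪 hli𝔪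
  -- along `V(𝔭) ∩ D(h₁) ∩ {dim ≤ 3}`: the top `ι₀`-stratum of `A_𝔮` is `V(𝔭 A_𝔮)`, and the transversal letter is `σ (A_𝔭) F`
  have hσ : ∀ (𝔮 : Ideal A) [𝔮.IsPrime], 𝔭 ≤ 𝔮 → h₁ ∉ 𝔮 → ringKrullDim (Localization.AtPrime 𝔮) ≤ 3 →
      topStratum iotaOrdEpsTau (Localization.AtPrime 𝔮) (algebraMap A (Localization.AtPrime 𝔮) F) =
        {𝔮₀' | 𝔭.map (algebraMap A (Localization.AtPrime 𝔮)) ≤ 𝔮₀'.asIdeal} ∧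
      iotaCylinder iotaOrdEpsTau iotaSigma (Localization.AtPrime 𝔮) (algebraMap A (Localization.AtPrime 𝔮) F) =
        iotaSigma (Localization.AtPrime 𝔭) (algebraMap A (Localization.AtPrime 𝔭) F) := by
    intro 𝔮 _ h𝔭𝔮 hh₁𝔮 hdim𝔮
    have hE := topStratum_atPrime_eq_of_stratumIffLE iotaOrdEpsTau iotaOrdEpsTau_isoInvariant 𝔪 𝔭 F 3 hiff₀ hsq 𝔮
      h𝔭𝔮 hh₁𝔮 hh₁𝔮 hdim𝔮
    haveI := isPrime_map_atPrime_of_le 𝔭 𝔮 h𝔭𝔮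
    refine ⟨hE, ?_⟩
    rw [iotaCylinder_eq_of_topStratum_eq iotaOrdEpsTau iotaSigma _ _ hE,
      StratumIff.iota_localization_localization_eq iotaSigma iotaSigma_isoInvariant 𝔮 _ F,
      StratumIff.iota_localization_congr iotaSigma (comap_map_atPrime_of_le 𝔭 𝔮 h𝔭𝔮) F]
  refine ⟨h₀ * h₁ * hb * f, fun hm => ?_, fun 𝔮 _ hh𝔮 hdim𝔮 => ?_⟩
  · rcases Ideal.IsPrime.mem_or_mem ‹𝔪.IsPrime› hm with hm | hm
    · rcases Ideal.IsPrime.mem_or_mem ‹𝔪.IsPrime› hm with hm | hm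
      · exact (Ideal.IsPrime.mem_or_mem ‹𝔪.IsPrime› hm).elim hh₀ hh₁
      · exact hhb hm
    · exact hf𝔪 hm
  have hh₀𝔮 : h₀ ∉ 𝔮 := fun h => hh𝔮 (Ideal.mul_mem_right _ _ (Ideal.mul_mem_right _ _ (Ideal.mul_mem_right _ _ h)))
  have hh₁𝔮 : h₁ ∉ 𝔮 := fun h => hh𝔮 (Ideal.mul_mem_right _ _ (Ideal.mul_mem_right _ _ (Ideal.mul_mem_left _ _ h)))
  have hhb𝔮 : hb ∉ 𝔮 := fun h => hh𝔮 (Ideal.mul_mem_right _ _ (Ideal.mul_mem_left _ _ h))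
  have hf𝔮 : f ∉ 𝔮 := fun h => hh𝔮 (Ideal.mul_mem_left _ _ h)
  -- the transversal letter at `𝔪` itself
  have hσ𝔪 := (hσ 𝔪 h𝔭𝔪 hh₁ hdim𝔪).2
  refine ⟨?_, fun hU𝔮 m => ?_⟩
  · rw [hUiff 𝔮 hhb𝔮]
    constructor
    · intro h𝔭𝔮
      obtain ⟨hF2, hι₀⟩ := (hiff₀ 𝔮 hh₁𝔮 hdim𝔮).mp h𝔭𝔮
      refine ⟨hF2, (iotaFlatT_eq_iff _ _ _ _).mpr ⟨hι₀, ?_⟩⟩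
      rw [(hσ 𝔮 h𝔭𝔮 hh₁𝔮 hdim𝔮).2, hσ𝔪]
    · rintro ⟨hF2, hι⟩
      exact (hiff₀ 𝔮 hh₁𝔮 hdim𝔮).mpr ⟨hF2, ((iotaFlatT_eq_iff _ _ _ _).mp hι).1⟩
  · have h𝔭𝔮 : 𝔭 ≤ 𝔮 := (hUiff 𝔮 hhb𝔮).mp hU𝔮
    obtain ⟨hreg𝔮, hU𝔮', hli𝔮⟩ := hspread 𝔮 hf𝔮 hU𝔮
    haveI := hreg𝔮
    haveI := isPrime_map_atPrime_of_le 𝔭 𝔮 h𝔭𝔮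
    -- `dim (A_𝔮)_{𝔭 A_𝔮} = dim A_𝔭 ≤ 2`
    haveI := isLocalizationAtPrime_atPrime_map 𝔭 𝔮 h𝔭𝔮
    have hdim' : ringKrullDim (Localization.AtPrime (𝔭.map (algebraMap A (Localization.AtPrime 𝔮)))) ≤ 2 := by
      let e : Localization.AtPrime (𝔭.map (algebraMap A (Localization.AtPrime 𝔮))) ≃+* Localization.AtPrime 𝔭 :=
        (IsLocalization.algEquiv 𝔭.primeCompl
          (Localization.AtPrime (𝔭.map (algebraMap A (Localization.AtPrime 𝔮)))) (Localization.AtPrime 𝔭)).toRingEquiv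
      rw [RingEquiv.ringKrullDim e]
      exact hdim𝔭
    rw [jFlatT_eq_cylinderAt_jContact _ _ m (hσ 𝔮 h𝔭𝔮 hh₁𝔮 hdim𝔮).1 hdim',
      cylinderAt_localization jContact jContact_isoInvariant A 𝔭 𝔮 h𝔭𝔮 F m]
    exact hpres 𝔮 hh₀𝔮 h𝔭𝔮 hdim𝔮 hreg𝔮 ⟨hU𝔮', hli𝔮⟩ m

end JOpenLE3

end Summit.ResolutionOfSingularities.ResolutionOfSingularities.Theorems

end
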